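import Mathlib
import Summits.MatrixMultiplication.Statement
import Summits.MatrixMultiplication.MatrixMultiplication.Theorems.GraphEquationsFlatEngine

/-!
# Second-order separation: the bilinear core of the purification dial (`GraphEquations`, M61)

Decomp-mm node «GraphEquations» (lens 5, g42); attacked leaf `MultiplicityReduction`
(stmt-MatrixMultiplication-27806).  Target VERBATIM: `_root_.MatrixMultiplication`.  Route-neutral.

The SECOND-ORDER rows of a horizontal flat are `M_i W` for the symmetric products `W = U_aV_b + U_bV_a`
of its directions (M58).  Two facts isolate the bilinear core of the cell's question (Q*):

* `Correct.eq_zero_of_isKer_of_forall_mulVec` — **at EVERY base the second-order functionals over ALL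
  `W` separate the kernel**: a kernel vector `δ` with `δᵀ M_i W = 0` for all `i, W` has all kernel
  quadrics `δᵀ M_i δ = 0`, hence `δ = 0` (M40).  So only the NUMBER of product directions is at stake.
* `SecondOrderSeparates S A B W` («the `s` matrices `W_j` separate `K(A,B)` through `δ ↦ δᵀ M_i W_j`»)
  and **`eq_zero_of_persistsAlongFlat_snoc`**: the flat with directions `(W_1,0), …, (W_s,0), (0,𝟙)`
  has the products `W_j·𝟙 = W_j` among its second-order rows, so second-order separation by `s`
  matrices gives purification depth `φ ≤ s + 1` at the same base:
  `SecondOrderSeparation s n → HorizontalUnmask (s+1) n → (n ≥ 3) CEFM` (M60b).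
The dial (Q*) for g43 is therefore: do `O(1)` matrices `W_j` exist, at SOME base, with
`{δ ∈ K : δᵀ M_i W_j = 0 ∀ i j} = 0`, for every correct cubic system?
Sources: [BurgisserClausenShokrollahi1997, §4.1 Rem. (4.3), (7.7), Problem 16.3];
[LeykinVerscheldeZhao2006, Thm. 3.1].  No `sorry`.
-/

-- dupNamespace: forced by the nested Summit.MatrixMultiplication.MatrixMultiplication layout (D-0017)
set_option linter.dupNamespace false

noncomputable section

namespace Summit.MatrixMultiplication.MatrixMultiplication.Theorems.GraphEquations

open Matrix MvPolynomial
open Literature.Computability.AlgebraicComplexity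

variable {n : ℕ}

namespace AffSystem

variable {S : AffSystem n}

/-- **Second-order functionals over all `W` separate the kernel at every base**: a kernel vector
killed by every `δ ↦ (M_i W)·δ` is `0` (take `W = δ`: all kernel quadrics vanish; M40). -/
theorem Correct.eq_zero_of_isKer_of_forall_mulVec (hC : S.Correct) {A B δ : Vec n}
    (hK : S.IsKer A B δ) (h : ∀ i (W : Vec n), ((S.test i).M *ᵥ W) ⬝ᵥ δ = 0) : δ = 0 :=
  hC.eq_zero_of_isKer_of_quad hK fun i => h i δ

/-- `W_1, …, W_s` SEPARATE the kernel at `(A,B)` through the second-order pairing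
`δ ↦ (δᵀ M_i W_j)_{i,j}`. -/
def SecondOrderSeparates (S : AffSystem n) (A B : Vec n) {s : ℕ} (W : Fin s → Vec n) : Prop :=
  ∀ δ : Vec n, S.IsKer A B δ → (∀ i j, ((S.test i).M *ᵥ W j) ⬝ᵥ δ = 0) → δ = 0

/-- The `A`-directions `(W_j, 0)` followed by the `B`-direction `(0, 𝟙)`. -/
def snocDirA {s : ℕ} (W : Fin s → Vec n) : Fin (s + 1) → Vec n := Fin.snoc W 0

/-- … and their `B`-components `0, …, 0, 𝟙`. -/
def snocDirB (n s : ℕ) : Fin (s + 1) → Vec n := Fin.snoc (fun _ => 0) idFun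

/-- **Second-order separation by `s` matrices gives purification depth `≤ s + 1`**: no nonzero kernel
vector persists along the flat `(A,B) + span{(W_j,0), (0,𝟙)}` (the line `(W_j, 𝟙)` inside it has
second-order row `M_i (W_j 𝟙) = M_i W_j`). -/
theorem eq_zero_of_persistsAlongFlat_snoc {A B : Vec n} {s : ℕ} {W : Fin s → Vec n}
    (hW : S.SecondOrderSeparates A B W) {δ : Vec n}
    (h : S.PersistsAlongFlat A B (snocDirA W) (snocDirB n s) δ) : δ = 0 := by
  obtain ⟨hK, -, hpair⟩ := AffSystem.persistsAlongFlat_iff_pairwise.1 h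
  refine hW δ hK fun i j => ?_
  have hl := hpair (Fin.castSucc j) (Fin.last s)
  simp only [snocDirA, snocDirB, Fin.snoc_castSucc, Fin.snoc_last, add_zero, zero_add] at hl
  have := (AffSystem.persistsAlong_iff.1 hl).2.2 i
  rwa [prodVec_idFun] at this

/-- With ALL `n²` coordinate matrices the separation holds at every base of a correct system
(`eq_zero_of_isKer_of_forall_mulVec`), so again the content is `s` bounded independently of `n`. -/
theorem Correct.secondOrderSeparates_basis (hC : S.Correct) (A B : Vec n) (e : Fin (n * n) ≃ Fin n × Fin n) :
    S.SecondOrderSeparates A B (fun j => Pi.single (e j) (1 : ℂ)) := by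
  classical
  intro δ hK h
  refine hC.eq_zero_of_isKer_of_forall_mulVec hK fun i W => ?_
  have hW : W = ∑ j, W (e j) • Pi.single (e j) (1 : ℂ) := by
    rw [e.sum_comp (fun p => W p • Pi.single p (1 : ℂ))]
    funext q
    simp [Finset.sum_apply, Pi.single_apply]
  rw [hW, mulVec_sum, sum_dotProduct]
  exact Finset.sum_eq_zero fun j _ => by rw [mulVec_smul, smul_dotProduct, h i j, smul_zero]

end AffSystem

/-! ## The dial `SecondOrderSeparation s n` -/

/-- **`SecondOrderSeparation s n`.**  Every correct CUBIC system for `W_n`, in any affine normal form,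
has a base `(A,B)` and `s` matrices `W_j` separating the kernel through `δ ↦ δᵀ M_i W_j`. -/
def SecondOrderSeparation (s n : ℕ) : Prop :=
  ∀ E : EqSystem n, E.Correct → E.IsCubic →
    ∀ g : Fin E.tests.length → AffTest n,
      (∀ o A B C, MvPolynomial.eval (pt A B C) (E.testPoly (E.tests.get o)) = (g o).eval A B C) →
        ∃ (A B : Vec n) (W : Fin s → Vec n), (affSystemOf g).SecondOrderSeparates A B W

/-- `SecondOrderSeparation s n → HorizontalUnmask (s+1) n`. -/
theorem horizontalUnmask_of_secondOrderSeparation {s : ℕ} (h : SecondOrderSeparation s n) :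
    HorizontalUnmask (s + 1) n := by
  intro E hE hc g hg
  obtain ⟨A, B, W, hW⟩ := h E hE hc g hg
  exact ⟨A, B, AffSystem.snocDirA W, AffSystem.snocDirB n s,
    fun δ hδ => AffSystem.eq_zero_of_persistsAlongFlat_snoc hW hδ⟩

/-- `SecondOrderSeparation (n²) n` holds unconditionally (coordinate matrices, any base). -/
theorem secondOrderSeparation_sq (n : ℕ) : SecondOrderSeparation (n * n) n := by
  intro E hE hc g hg
  have e : Fin (n * n) ≃ Fin n × Fin n := (Fintype.equivFinOfCardEq (by simp)).symm
  exact ⟨0, 0, _, (affSystemOf_correct hE hg).secondOrderSeparates_basis 0 0 e⟩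

/-- **`(∀ n ≥ 3, SecondOrderSeparation s n) → CubicEquationsForceMultiplication`** for every FIXED `s`
(constant `2·9^{s+1}`). -/
theorem cubicEquationsForceMultiplication_of_secondOrderSeparation (s : ℕ)
    (h : ∀ n : ℕ, 3 ≤ n → SecondOrderSeparation s n) : CubicEquationsForceMultiplication :=
  cubicEquationsForceMultiplication_of_horizontalUnmask (s + 1)
    fun n hn => horizontalUnmask_of_secondOrderSeparation (h n hn)

end Summit.MatrixMultiplication.MatrixMultiplication.Theorems.GraphEquations

end
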